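import Literature.NumberTheory.LFunctions.ZetaLogNormVertical
import Literature.NumberTheory.LFunctions.DirichletLogDerivDisc
import HarnessLib

/-!
# `log|L(σ + it, χ)|` on vertical lines (`χ ≠ χ₀`): local `L¹` bounds and integrability against `sech²`

Topic `Literature/NumberTheory/LFunctions`.  Everything in this file is PROVED; no definition, no
named fact.  This is the Dirichlet-`L`-function companion of `ZetaLogNormVertical.lean` (which
does `ζ₁ = (s − 1)ζ(s)`), written for the `L`-function version of Ford's zero detector — Lemmas 6.1
and 6.2 of T. Khale, *An explicit Vinogradov–Korobov zero-free region for Dirichlet L-functions*,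
Q. J. Math. 75 (2024) = arXiv:2210.06457 (= Lemma 2.2 / 4.1 of Ford, *Zero-free regions for the
Riemann zeta function*, 2002, for `f = L(·, χ)`), whose conclusion contains the integrals
`∫_{−∞}^{∞} log|L(s ∓ η + 2ηiu/π, χ)|/cosh²u du` over whole vertical lines through whatever zeros of
`L(s, χ)` lie on or near them.  Khale (proof of Lemma 5.2): "even if `L(σ + it + iau, χ) = 0` on the
path of integration, the integral … converges, since all zeros have finite order."  This file proves
that convergence (absolute integrability) for every non-principal `χ` modulo any `q ≥ 1`, from
Titchmarsh's Theorem 9.6 (B) for `L(s, χ)` — `log L(s, χ) = Σ_{|t−γ|≤1} log(s − ρ) + O(log q(|t|+2))`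
— itself obtained from the tree's Landau lemma in logarithmic form
(`Literature.Analysis.Complex.log_norm_sub_sum_log_mem_Icc`) on the Jensen discs
`|s − (2 + it)| ≤ 8/5 < 81/50 < 7/4` of `DirichletLogDerivDisc.lean` (the zeros
`DirichletDisc.discZeros χ t`, the growth bound `‖L‖ ≤ q(|t|+4)Z` on the disc, `‖L(2+it, χ)‖ ≥ 1/2`,
and the Jensen count `Σ m(ρ) ≤ C ℒ`, `ℒ = log q + log(|t| + 4)`); all constants are ABSOLUTE.

* `exists_abs_log_norm_LFunction_sub_sum_le` — **Titchmarsh 9.6 (B) for `L(s, χ)`, disc form**: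
  an absolute `C` with `|log|L(s, χ)| − Σ_{ρ ∈ discZeros χ t} m(ρ) log|s − ρ|| ≤ C ℒ` for
  `|s − (2 + it)| ≤ 8/5`, `L(s, χ) ≠ 0`;
* `exists_abs_log_norm_LFunction_le` — the pointwise majorant on the segments `σ ∈ [1/2, 3]`,
  `|y − t| ≤ 1/2`: `|log|L(σ+iy, χ)|| ≤ C ℒ + Σ m(ρ)(−log|y − Im ρ|)⁺` off the ordinates;
* `exists_setIntegral_abs_log_norm_LFunction_le` — **the local `L¹` bound**:
  `∫_{t−1/2}^{t+1/2} |log|L(σ + iy, χ)|| dy ≤ C ℒ(t)` uniformly in `σ ∈ [1/2, 3]`, `q`, `χ ≠ χ₀`;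
* `integrable_log_norm_LFunction_div_cosh_sq` — **`y ↦ log|L(σ + iy, χ)| / cosh²(ν(y − y₀))` is
  integrable on `ℝ`** (`1/2 ≤ σ ≤ 3`, `ν > 0`), via unit windows and `Σ_n e^{−ν|n|} < ∞`;
* `integrable_log_norm_LFunction_ford` — Ford's/Khale's parametrisation
  `u ↦ log|L(σ + i(t + au), χ)|/cosh²u` (`a > 0`).

## References

* E. C. Titchmarsh, *The Theory of the Riemann Zeta-Function*, 2nd ed. (rev. D. R. Heath-Brown),
  Oxford 1986, Thm. 9.6 (B), §3.9 Lemma α. [Titchmarsh1986]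
* T. Khale, arXiv:2210.06457v1, Lemma 5.2 (first paragraph of the proof), Lemmas 6.1–6.2. [Khale2024]
* H. L. Montgomery, R. C. Vaughan, *Multiplicative Number Theory I*, CUP 2007, Lemma 12.1,
  Thm. 10.13 (through `DirichletLogDerivDisc.lean`). [MontgomeryVaughan2007]
-/

noncomputable section

open Complex Set Metric Filter Topology MeasureTheory Real

namespace Literature.NumberTheory.LFunctions

namespace DirichletLogNormVertical

open DirichletDisc ZetaLogNormVertical

/-! ### Titchmarsh's Theorem 9.6 (B) for `L(s, χ)` on the discs `|s − (2 + it)| ≤ 8/5` -/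

/-- **Titchmarsh Thm. 9.6 (B) for `L(s, χ)`, disc form, all `t`, uniformly in `q`.** There is an
absolute `C` such that for every `q ≥ 1`, every `χ ≠ χ₀` mod `q`, every real `t` and every `s` with
`|s − (2 + it)| ≤ 8/5` and `L(s, χ) ≠ 0`,
`|log|L(s, χ)| − Σ_{ρ ∈ discZeros χ t} m(ρ) log|s − ρ|| ≤ C (log q + log(|t| + 4))`
(the zeros of `L(s, χ)` in `|s − (2 + it)| ≤ 81/50` with their multiplicities).
[cite: Titchmarsh1986, Thm. 9.6 (B)] -/
theorem exists_abs_log_norm_LFunction_sub_sum_le :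
    ∃ C : ℝ, 0 < C ∧ ∀ (q : ℕ) [NeZero q] (χ : DirichletCharacter ℂ q), χ ≠ 1 → ∀ t : ℝ,
      ∀ s ∈ closedBall (2 + (t : ℂ) * I) (8 / 5), χ.LFunction s ≠ 0 →
      |Real.log ‖χ.LFunction s‖ -
          ∑ ρ ∈ discZeros χ t, (discDivisor χ t ρ : ℝ) * Real.log ‖s - ρ‖| ≤
        C * (Real.log q + Real.log (|t| + 4)) := by
  obtain ⟨C₂, hC₂0, hC₂⟩ := exists_sum_discZeros_le
  set A₀ : ℝ := Real.log (2 * Zc) + 1 with hA₀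
  have hZ1 : 1 ≤ Zc := one_le_Zc
  have hA₀0 : 0 < A₀ := by
    rw [hA₀]; have := Real.log_nonneg (show (1 : ℝ) ≤ 2 * Zc by linarith); linarith
  -- the constant
  set C : ℝ := Real.log 2 + C₂ * |Real.log (81 / 50)| +
    160 * (A₀ + C₂ * Real.log (175 / 13) + 1) + (Real.log Zc + 1) + C₂ * Real.log (100 / 13) with hC
  have hlog2 : 0 ≤ Real.log (2 : ℝ) := Real.log_nonneg (by norm_num)
  have hlog17513 : 0 ≤ Real.log (175 / 13 : ℝ) := Real.log_nonneg (by norm_num)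
  have hlog10013 : 0 ≤ Real.log (100 / 13 : ℝ) := Real.log_nonneg (by norm_num)
  have hlogZ : 0 ≤ Real.log Zc := Real.log_nonneg hZ1
  refine ⟨C, by positivity, fun q _ χ hχ t s hs hL ↦ ?_⟩
  set ℒ : ℝ := Real.log q + Real.log (|t| + 4) with hℒ
  have hℒ1 : 1 ≤ ℒ := DirichletZFR.one_le_ell q t
  have hℒ0 : 0 ≤ ℒ := by linarith
  have hq1 : (1 : ℝ) ≤ q := by exact_mod_cast NeZero.one_le
  have hlogq : 0 ≤ Real.log (q : ℝ) := Real.log_nonneg hq1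
  have hlog4' : 0 ≤ Real.log (|t| + 4) := Real.log_nonneg (by linarith [abs_nonneg t])
  set c : ℂ := 2 + (t : ℂ) * I with hc
  have h := Literature.Analysis.Complex.log_norm_sub_sum_log_mem_Icc (f := χ.LFunction) (c := c)
    (r₁ := 8 / 5) (R₂ := 81 / 50) (R := 7 / 4) (B := q * (|t| + 4) * Zc)
    (by norm_num) (by norm_num) (by norm_num)
    (analyticOnNhd_LFunction χ hχ _ _) (LFunction_two_add_ne_zero χ t)
    (fun z hz ↦ norm_LFunction_le_of_mem_closedBall χ hχ t hz) hs hL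
  change Real.log ‖χ.LFunction c‖ - (∑ ρ ∈ discZeros χ t, (discDivisor χ t ρ : ℝ)) *
      Real.log (81 / 50) - 2 * (8 / 5) / (81 / 50 - 8 / 5) *
        (Real.log (q * (|t| + 4) * Zc / ‖χ.LFunction c‖) +
          (∑ ρ ∈ discZeros χ t, (discDivisor χ t ρ : ℝ)) * Real.log (7 / 4 / (7 / 4 - 81 / 50)) + 1)
      ≤ Real.log ‖χ.LFunction s‖ - ∑ ρ ∈ discZeros χ t, (discDivisor χ t ρ : ℝ) * Real.log ‖s - ρ‖ ∧
    Real.log ‖χ.LFunction s‖ - ∑ ρ ∈ discZeros χ t, (discDivisor χ t ρ : ℝ) * Real.log ‖s - ρ‖ ≤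
      Real.log (q * (|t| + 4) * Zc) -
        (∑ ρ ∈ discZeros χ t, (discDivisor χ t ρ : ℝ)) * Real.log (7 / 4 - 81 / 50) at h
  set N : ℝ := ∑ ρ ∈ discZeros χ t, (discDivisor χ t ρ : ℝ) with hN
  have hN0 : 0 ≤ N := Finset.sum_nonneg fun ρ _ ↦ by exact_mod_cast discDivisor_nonneg hχ t ρ
  have hNle : N ≤ C₂ * ℒ := hC₂ q χ hχ t
  have hLg := DirichletDisc.log_bound_div_norm_le χ t
  rw [← hA₀] at hLg
  -- numerical simplifications
  have e1 : (2 : ℝ) * (8 / 5) / (81 / 50 - 8 / 5) = 160 := by norm_num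
  have e2 : (7 : ℝ) / 4 / (7 / 4 - 81 / 50) = 175 / 13 := by norm_num
  have e3 : (7 : ℝ) / 4 - 81 / 50 = 13 / 100 := by norm_num
  rw [e1, e2, e3] at h
  have hlogB : Real.log (q * (|t| + 4) * Zc) = Real.log q + Real.log (|t| + 4) + Real.log Zc := by
    rw [Real.log_mul (by positivity) (by positivity), Real.log_mul (by positivity) (by positivity)]
  have hlog13 : Real.log (13 / 100 : ℝ) = -Real.log (100 / 13) := by
    rw [show (13 / 100 : ℝ) = (100 / 13)⁻¹ by norm_num, Real.log_inv]
  rw [hlogB, hlog13] at h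
  -- log ‖L(c)‖ ≥ -log 2
  have hLc : -Real.log 2 ≤ Real.log ‖χ.LFunction c‖ := by
    have h12 := half_le_norm_LFunction_two_add χ t
    have := Real.log_le_log (by norm_num) h12
    rwa [show (1 / 2 : ℝ) = 2⁻¹ by norm_num, Real.log_inv] at this
  obtain ⟨h1, h2⟩ := h
  rw [abs_le]
  constructor
  · -- lower bound
    have hA : Real.log (q * (|t| + 4) * Zc / ‖χ.LFunction c‖) ≤ A₀ * ℒ := hLg
    have hB : N * Real.log (175 / 13) ≤ C₂ * Real.log (175 / 13) * ℒ := by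
      have := mul_le_mul_of_nonneg_right hNle hlog17513
      linarith [this]
    have hM : Real.log (q * (|t| + 4) * Zc / ‖χ.LFunction c‖) + N * Real.log (175 / 13) + 1 ≤
        (A₀ + C₂ * Real.log (175 / 13) + 1) * ℒ := by
      have e : (A₀ + C₂ * Real.log (175 / 13) + 1) * ℒ =
          A₀ * ℒ + C₂ * Real.log (175 / 13) * ℒ + ℒ := by ring
      rw [e]; linarith
    have hNl : N * Real.log (81 / 50) ≤ C₂ * |Real.log (81 / 50)| * ℒ := by
      calc N * Real.log (81 / 50) ≤ N * |Real.log (81 / 50)| :=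
            mul_le_mul_of_nonneg_left (le_abs_self _) hN0
        _ ≤ C₂ * ℒ * |Real.log (81 / 50)| := mul_le_mul_of_nonneg_right hNle (abs_nonneg _)
        _ = _ := by ring
    have hLc' : -(Real.log 2 * ℒ) ≤ Real.log ‖χ.LFunction c‖ := by
      have h4 : Real.log 2 ≤ Real.log 2 * ℒ := le_mul_of_one_le_right hlog2 hℒ1
      linarith
    have h5 : 0 ≤ (Real.log Zc + 1) * ℒ := by positivity
    have h6 : 0 ≤ C₂ * Real.log (100 / 13) * ℒ := by positivity
    have h7 : 0 ≤ (A₀ + C₂ * Real.log (175 / 13) + 1) * ℒ := by positivity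
    have e : C * ℒ = Real.log 2 * ℒ + C₂ * |Real.log (81 / 50)| * ℒ +
        160 * ((A₀ + C₂ * Real.log (175 / 13) + 1) * ℒ) +
        (Real.log Zc + 1) * ℒ + C₂ * Real.log (100 / 13) * ℒ := by
      rw [hC]; ring
    rw [e]
    linarith
  · -- upper bound
    have h3 : N * Real.log (100 / 13) ≤ C₂ * Real.log (100 / 13) * ℒ := by
      have := mul_le_mul_of_nonneg_right hNle hlog10013
      linarith [this]
    have h4 : Real.log Zc ≤ Real.log Zc * ℒ := le_mul_of_one_le_right hlogZ hℒ1
    have h5 : 0 ≤ Real.log 2 * ℒ := by positivity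
    have h6 : 0 ≤ C₂ * |Real.log (81 / 50)| * ℒ := by positivity
    have h7 : 0 ≤ (A₀ + C₂ * Real.log (175 / 13) + 1) * ℒ := by positivity
    have e : C * ℒ = Real.log 2 * ℒ + C₂ * |Real.log (81 / 50)| * ℒ +
        160 * ((A₀ + C₂ * Real.log (175 / 13) + 1) * ℒ) +
        (Real.log Zc * ℒ + ℒ) + C₂ * Real.log (100 / 13) * ℒ := by
      rw [hC]; ring
    rw [e]
    have : -(N * -Real.log (100 / 13)) = N * Real.log (100 / 13) := by ring
    linarith

/-! ### A pointwise majorant on vertical segments -/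

/-- The point `σ + iy` with `1/2 ≤ σ ≤ 3`, `|y − t| ≤ 1/2` lies in the disc `|s − (2 + it)| ≤ 8/5`
(`(3/2)² + (1/2)² = 5/2 ≤ (8/5)²`). [folklore] -/
theorem mem_closedBall_eight_fifths {σ t y : ℝ} (hσ : σ ∈ Icc (1 / 2 : ℝ) 3) (hy : |y - t| ≤ 1 / 2) :
    (σ : ℂ) + y * I ∈ closedBall (2 + (t : ℂ) * I) (8 / 5) := by
  rw [mem_closedBall, dist_eq_norm, show (σ : ℂ) + y * I - (2 + t * I) = ((σ - 2 : ℝ) : ℂ) +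
    ((y - t : ℝ) : ℂ) * I by push_cast; ring]
  rw [← sq_le_sq₀ (norm_nonneg _) (by norm_num), Complex.sq_norm, Complex.normSq_add_mul_I]
  rw [abs_le] at hy
  nlinarith [hσ.1, hσ.2, hy.1, hy.2]

/-- **Pointwise majorant for `log|L(·, χ)|` on vertical segments.** There is an absolute `C` such
that for every `q`, `χ ≠ χ₀` mod `q`, all real `t`, `σ ∈ [1/2, 3]` and `|y − t| ≤ 1/2` with `y` not
the ordinate of a zero of the disc `|s − (2 + it)| ≤ 81/50`:
`|log|L(σ + iy, χ)|| ≤ C ℒ + Σ_{ρ ∈ discZeros χ t} m(ρ) (−log|y − Im ρ|)⁺`.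
[cite: Titchmarsh1986, Thm. 9.6 (B)] -/
theorem exists_abs_log_norm_LFunction_le :
    ∃ C : ℝ, 0 < C ∧ ∀ (q : ℕ) [NeZero q] (χ : DirichletCharacter ℂ q), χ ≠ 1 → ∀ t σ y : ℝ,
      σ ∈ Icc (1 / 2 : ℝ) 3 → |y - t| ≤ 1 / 2 → (∀ ρ ∈ discZeros χ t, y ≠ ρ.im) →
      |Real.log ‖χ.LFunction (σ + y * I)‖| ≤ C * (Real.log q + Real.log (|t| + 4)) +
        ∑ ρ ∈ discZeros χ t, (discDivisor χ t ρ : ℝ) * max (-Real.log |y - ρ.im|) 0 := by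
  obtain ⟨C₁, hC₁0, hC₁⟩ := exists_abs_log_norm_LFunction_sub_sum_le
  obtain ⟨C₂, hC₂0, hC₂⟩ := exists_sum_discZeros_le
  refine ⟨C₁ + C₂ * Real.log 4, by positivity, fun q _ χ hχ t σ y hσ hy hord ↦ ?_⟩
  set ℒ : ℝ := Real.log q + Real.log (|t| + 4) with hℒ
  have hℒ0 : 0 ≤ ℒ := le_trans zero_le_one (DirichletZFR.one_le_ell q t)
  have hlog4 : 0 ≤ Real.log (4 : ℝ) := Real.log_nonneg (by norm_num)
  have hm0 : ∀ ρ, 0 ≤ (discDivisor χ t ρ : ℝ) := fun ρ ↦ by exact_mod_cast discDivisor_nonneg hχ t ρ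
  have hsum0 : 0 ≤ ∑ ρ ∈ discZeros χ t, (discDivisor χ t ρ : ℝ) * max (-Real.log |y - ρ.im|) 0 :=
    Finset.sum_nonneg fun ρ _ ↦ mul_nonneg (hm0 ρ) (le_max_right _ _)
  set s : ℂ := (σ : ℂ) + y * I with hs_def
  have hs : s ∈ closedBall (2 + (t : ℂ) * I) (8 / 5) := mem_closedBall_eight_fifths hσ hy
  by_cases hL : χ.LFunction s = 0
  · rw [hL, norm_zero, Real.log_zero, abs_zero]
    positivity
  have h1 := hC₁ q χ hχ t s hs hL
  have hsim : s.im = y := by simp [hs_def]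
  have hs95 : s ∈ closedBall (2 + (t : ℂ) * I) (9 / 5) := closedBall_subset_closedBall (by norm_num) hs
  have h2 : |∑ ρ ∈ discZeros χ t, (discDivisor χ t ρ : ℝ) * Real.log ‖s - ρ‖| ≤
      (∑ ρ ∈ discZeros χ t, (discDivisor χ t ρ : ℝ)) * Real.log 4 +
        ∑ ρ ∈ discZeros χ t, (discDivisor χ t ρ : ℝ) * max (-Real.log |y - ρ.im|) 0 := by
    refine (Finset.abs_sum_le_sum_abs _ _).trans ?_
    rw [Finset.sum_mul, ← Finset.sum_add_distrib]
    refine Finset.sum_le_sum fun ρ hρ ↦ ?_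
    rw [abs_mul, abs_of_nonneg (hm0 ρ), ← mul_add]
    refine mul_le_mul_of_nonneg_left ?_ (hm0 ρ)
    have hρ' : ρ ∈ closedBall (2 + (t : ℂ) * I) (37 / 20) :=
      closedBall_subset_closedBall (by norm_num) ((mem_discZeros hχ).1 hρ).1
    have := abs_log_norm_sub_le hs95 hρ' (by rw [hsim]; exact hord ρ hρ)
    rwa [hsim] at this
  have h3 : (∑ ρ ∈ discZeros χ t, (discDivisor χ t ρ : ℝ)) * Real.log 4 ≤ C₂ * Real.log 4 * ℒ := by
    have := mul_le_mul_of_nonneg_right (hC₂ q χ hχ t) hlog4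
    linarith
  have h4 := abs_sub_abs_le_abs_sub (Real.log ‖χ.LFunction s‖)
    (∑ ρ ∈ discZeros χ t, (discDivisor χ t ρ : ℝ) * Real.log ‖s - ρ‖)
  have e : (C₁ + C₂ * Real.log 4) * ℒ = C₁ * ℒ + C₂ * Real.log 4 * ℒ := by ring
  rw [e]
  linarith

/-! ### The local `L¹` bound (Titchmarsh Thm. 9.6 (B), integrated) -/

/-- `y ↦ log|L(σ + iy, χ)|` is measurable (`χ ≠ χ₀`). [folklore] -/
theorem measurable_log_norm_LFunction {q : ℕ} [NeZero q] {χ : DirichletCharacter ℂ q} (hχ : χ ≠ 1)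
    (σ : ℝ) : Measurable fun y : ℝ ↦ Real.log ‖χ.LFunction (σ + y * I)‖ :=
  Real.measurable_log.comp
    (((DirichletCharacter.differentiable_LFunction hχ).continuous.comp (by fun_prop)).norm).measurable

/-- **Local `L¹` bound for `log|L(·, χ)|` on vertical lines, uniformly in `q`.** There is an absolute
`C` such that for every `q`, `χ ≠ χ₀` mod `q`, all real `t` and `σ ∈ [1/2, 3]`,
`y ↦ log|L(σ + iy, χ)|` is integrable on `[t − 1/2, t + 1/2]` and
`∫_{t−1/2}^{t+1/2} |log|L(σ + iy, χ)|| dy ≤ C (log q + log(|t| + 4))` — zeros on or near the line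
included. [cite: Titchmarsh1986, Thm. 9.6 (B)] -/
theorem exists_setIntegral_abs_log_norm_LFunction_le :
    ∃ C : ℝ, 0 < C ∧ ∀ (q : ℕ) [NeZero q] (χ : DirichletCharacter ℂ q), χ ≠ 1 → ∀ t σ : ℝ,
      σ ∈ Icc (1 / 2 : ℝ) 3 →
      IntegrableOn (fun y : ℝ ↦ Real.log ‖χ.LFunction (σ + y * I)‖) (Icc (t - 1 / 2) (t + 1 / 2)) ∧
      ∫ y in Icc (t - 1 / 2) (t + 1 / 2), |Real.log ‖χ.LFunction (σ + y * I)‖| ≤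
        C * (Real.log q + Real.log (|t| + 4)) := by
  obtain ⟨C₁, hC₁0, hC₁⟩ := exists_abs_log_norm_LFunction_le
  obtain ⟨C₂, hC₂0, hC₂⟩ := exists_sum_discZeros_le
  refine ⟨C₁ + 2 * C₂, by positivity, fun q _ χ hχ t σ hσ ↦ ?_⟩
  set ℒ : ℝ := Real.log q + Real.log (|t| + 4) with hℒ
  have hℒ0 : 0 ≤ ℒ := le_trans zero_le_one (DirichletZFR.one_le_ell q t)
  set W : Set ℝ := Icc (t - 1 / 2) (t + 1 / 2) with hW
  have hWm : MeasurableSet W := measurableSet_Icc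
  have hWvol : volume W = 1 := by
    rw [hW, Real.volume_Icc]; norm_num
  have hm0 : ∀ ρ, 0 ≤ (discDivisor χ t ρ : ℝ) := fun ρ ↦ by exact_mod_cast discDivisor_nonneg hχ t ρ
  -- the majorant
  set G : ℝ → ℝ := fun y ↦ C₁ * ℒ +
    ∑ ρ ∈ discZeros χ t, (discDivisor χ t ρ : ℝ) * max (-Real.log |y - ρ.im|) 0 with hG
  have hGi : ∀ ρ : ℂ, Integrable fun y : ℝ ↦ (discDivisor χ t ρ : ℝ) * max (-Real.log |y - ρ.im|) 0 :=
    fun ρ ↦ (integrable_posPart_neg_log_abs.comp_sub_right ρ.im).const_mul _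
  have hconstI : IntegrableOn (fun _ : ℝ ↦ C₁ * ℒ) W := by
    refine integrableOn_const ?_
    rw [hWvol]; exact ENNReal.one_ne_top
  have hsumI : Integrable fun y : ℝ ↦
      ∑ ρ ∈ discZeros χ t, (discDivisor χ t ρ : ℝ) * max (-Real.log |y - ρ.im|) 0 :=
    integrable_finsetSum _ fun ρ _ ↦ hGi ρ
  have hGint : IntegrableOn G W := hconstI.add hsumI.integrableOn
  -- the bound holds off the (finite) set of ordinates
  set E : Set ℝ := (((discZeros χ t).image Complex.im : Finset ℝ) : Set ℝ) with hE
  have hE0 : volume E = 0 := (Finset.finite_toSet _).measure_zero volume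
  have haeE : ∀ᵐ y ∂(volume : Measure ℝ), y ∉ E := by
    rw [ae_iff]; simpa using hE0
  have hae : ∀ᵐ (y : ℝ) ∂(volume.restrict W), ‖Real.log ‖χ.LFunction (σ + y * I)‖‖ ≤ G y := by
    filter_upwards [ae_restrict_mem hWm, ae_restrict_of_ae haeE] with y hyW hyE
    rw [Real.norm_eq_abs]
    refine hC₁ q χ hχ t σ y hσ ?_ ?_
    · rw [hW, mem_Icc] at hyW
      rw [abs_le]; constructor <;> linarith [hyW.1, hyW.2]
    · intro ρ hρ h
      apply hyE
      rw [hE, Finset.coe_image]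
      exact ⟨ρ, hρ, h.symm⟩
  have hf : IntegrableOn (fun y : ℝ ↦ Real.log ‖χ.LFunction (σ + y * I)‖) W :=
    Integrable.mono' hGint (measurable_log_norm_LFunction hχ σ).aestronglyMeasurable hae
  refine ⟨hf, ?_⟩
  -- integrate the majorant
  have h1 : ∫ y in W, |Real.log ‖χ.LFunction (σ + y * I)‖| ≤ ∫ y in W, G y := by
    refine integral_mono_ae hf.norm hGint ?_
    filter_upwards [hae] with y hy
    simpa using hy
  have h2 : ∫ y in W, G y ≤ (C₁ + 2 * C₂) * ℒ := by
    have hconst : ∫ _ in W, C₁ * ℒ = C₁ * ℒ := by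
      rw [setIntegral_const, measureReal_def, hWvol]; simp
    have hsum : ∫ y in W, ∑ ρ ∈ discZeros χ t, (discDivisor χ t ρ : ℝ) *
        max (-Real.log |y - ρ.im|) 0 ≤ 2 * C₂ * ℒ := by
      rw [integral_finsetSum _ fun ρ _ ↦ (hGi ρ).integrableOn]
      calc ∑ ρ ∈ discZeros χ t, ∫ y in W, (discDivisor χ t ρ : ℝ) * max (-Real.log |y - ρ.im|) 0
          ≤ ∑ ρ ∈ discZeros χ t, (discDivisor χ t ρ : ℝ) * 2 := by
            refine Finset.sum_le_sum fun ρ _ ↦ ?_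
            rw [integral_const_mul]
            exact mul_le_mul_of_nonneg_left (setIntegral_posPart_neg_log_abs_sub_le W ρ.im) (hm0 ρ)
        _ = 2 * ∑ ρ ∈ discZeros χ t, (discDivisor χ t ρ : ℝ) := by
            rw [Finset.mul_sum]; exact Finset.sum_congr rfl fun ρ _ ↦ by ring
        _ ≤ 2 * (C₂ * ℒ) := by linarith [hC₂ q χ hχ t]
        _ = 2 * C₂ * ℒ := by ring
    rw [show (fun y ↦ G y) = fun y ↦ (fun _ : ℝ ↦ C₁ * ℒ) y +
        (fun y : ℝ ↦ ∑ ρ ∈ discZeros χ t, (discDivisor χ t ρ : ℝ) *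
          max (-Real.log |y - ρ.im|) 0) y from rfl, integral_add hconstI hsumI.integrableOn, hconst]
    linarith
  exact h1.trans h2

/-! ### Integrability against `sech²` on whole vertical lines -/

/-- **`log|L(σ + iy, χ)| sech²(ν(y − y₀))` is integrable on `ℝ`** for `χ ≠ χ₀`, `σ ∈ [1/2, 3]`,
`ν > 0` (unit windows: `∫_{n−1/2}^{n+1/2} |log|L|| ≪ log q + log(|n|+4)` against
`sech² ≤ 4e^{ν}e^{−2ν|n − y₀|}`). [cite: Titchmarsh1986, Thm. 9.6 (B)] -/
theorem integrable_log_norm_LFunction_div_cosh_sq {q : ℕ} [NeZero q] {χ : DirichletCharacter ℂ q}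
    (hχ : χ ≠ 1) {σ : ℝ} (hσ : σ ∈ Icc (1 / 2 : ℝ) 3) {ν : ℝ} (hν : 0 < ν) (y₀ : ℝ) :
    Integrable fun y : ℝ ↦ Real.log ‖χ.LFunction (σ + y * I)‖ / Real.cosh (ν * (y - y₀)) ^ 2 := by
  obtain ⟨C, hC0, hC⟩ := exists_setIntegral_abs_log_norm_LFunction_le
  have hq1 : (1 : ℝ) ≤ q := by exact_mod_cast NeZero.one_le
  have hlogq : 0 ≤ Real.log (q : ℝ) := Real.log_nonneg hq1
  set f : ℝ → ℝ := fun y ↦ Real.log ‖χ.LFunction (σ + y * I)‖ with hf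
  set g : ℝ → ℝ := fun y ↦ f y / Real.cosh (ν * (y - y₀)) ^ 2 with hg
  set s : ℤ → Set ℝ := fun n ↦ Icc ((n : ℝ) - 1 / 2) (n + 1 / 2) with hs
  have hgm : AEStronglyMeasurable g volume := by
    refine ((measurable_log_norm_LFunction hχ σ).div ?_).aestronglyMeasurable
    exact (by fun_prop : Continuous fun y : ℝ ↦ Real.cosh (ν * (y - y₀)) ^ 2).measurable
  -- integrability and bound on each window
  have hwin : ∀ n : ℤ, IntegrableOn g (s n) ∧
      ∫ y in s n, ‖g y‖ ≤ 4 * Real.exp ν * Real.exp (-(2 * ν * |(n : ℝ) - y₀|)) *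
        (C * (Real.log q + Real.log (|(n : ℝ)| + 4))) := by
    intro n
    obtain ⟨hfn, hIn⟩ := hC q χ hχ n σ hσ
    set w : ℝ := 4 * Real.exp ν * Real.exp (-(2 * ν * |(n : ℝ) - y₀|)) with hw
    have hw0 : 0 ≤ w := by positivity
    have hker : ∀ y ∈ s n, 1 / Real.cosh (ν * (y - y₀)) ^ 2 ≤ w := by
      intro y hy
      refine ((fun x : ℝ ↦ show 1 / Real.cosh x ^ 2 ≤ 4 * Real.exp (-(2 * |x|)) by
        have key := exp_two_mul_abs_le_four_mul_cosh_sq x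
        have hc : 0 < Real.cosh x := Real.cosh_pos x
        have hE : 0 < Real.exp (2 * |x|) := Real.exp_pos _
        rw [Real.exp_neg, div_le_iff₀ (pow_pos hc 2),
          show 4 * (Real.exp (2 * |x|))⁻¹ * Real.cosh x ^ 2 = (4 * Real.cosh x ^ 2) / Real.exp (2 * |x|) by
            ring, le_div_iff₀ hE]
        linarith) _).trans ?_
      rw [hw, mul_assoc]
      refine mul_le_mul_of_nonneg_left ?_ (by norm_num)
      rw [← Real.exp_add]
      refine Real.exp_le_exp.2 ?_
      rw [abs_mul, abs_of_pos hν]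
      have h1 : |(n : ℝ) - y₀| ≤ |y - y₀| + 1 / 2 := by
        have := abs_sub_le ((n : ℝ)) y y₀
        have hyn : |(n : ℝ) - y| ≤ 1 / 2 := by
          rw [hs, mem_Icc] at hy; rw [abs_le]; constructor <;> linarith [hy.1, hy.2]
        linarith
      nlinarith
    have hbound : ∀ y ∈ s n, ‖g y‖ ≤ w * |f y| := by
      intro y hy
      rw [hg, Real.norm_eq_abs]
      simp only
      rw [abs_div, abs_of_pos (by positivity : (0 : ℝ) < Real.cosh (ν * (y - y₀)) ^ 2),
        div_eq_mul_one_div, mul_comm]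
      exact mul_le_mul_of_nonneg_right (hker y hy) (abs_nonneg _)
    have hgn : IntegrableOn g (s n) := by
      refine Integrable.mono' (hfn.norm.const_mul w) hgm.restrict ?_
      filter_upwards [ae_restrict_mem measurableSet_Icc] with y hy
      simpa [Real.norm_eq_abs] using hbound y hy
    refine ⟨hgn, ?_⟩
    calc ∫ y in s n, ‖g y‖ ≤ ∫ y in s n, w * |f y| := by
          refine integral_mono_ae hgn.norm (hfn.norm.const_mul w) ?_
          filter_upwards [ae_restrict_mem measurableSet_Icc] with y hy
          simpa [Real.norm_eq_abs] using hbound y hy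
      _ = w * ∫ y in s n, |f y| := integral_const_mul _ _
      _ ≤ w * (C * (Real.log q + Real.log (|(n : ℝ)| + 4))) := mul_le_mul_of_nonneg_left hIn hw0
  -- summability of the window bounds
  set K : ℝ := 4 * Real.exp ν * C * (Real.log q + 1) * (1 / ν + |y₀| + 4) * Real.exp (ν * |y₀|) with hK
  have hsum : Summable fun n : ℤ ↦ ∫ y in s n, ‖g y‖ := by
    refine Summable.of_nonneg_of_le (fun n ↦ integral_nonneg fun y ↦ norm_nonneg _)
      (fun n ↦ (hwin n).2.trans ?_) ((summable_exp_neg_mul_abs_int hν).mul_left K)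
    set x : ℝ := |(n : ℝ) - y₀| with hx
    have hx0 : 0 ≤ x := abs_nonneg _
    have hlog : Real.log (|(n : ℝ)| + 4) ≤ x + |y₀| + 4 := by
      have h1 := Real.log_le_sub_one_of_pos (by linarith [abs_nonneg (n : ℝ)] : (0 : ℝ) < |(n : ℝ)| + 4)
      have h2 : |(n : ℝ)| ≤ x + |y₀| := by
        have := abs_add_le ((n : ℝ) - y₀) y₀; rwa [sub_add_cancel] at this
      linarith
    have hlog1 : 1 ≤ Real.log (|(n : ℝ)| + 4) := by
      rw [← Real.log_exp 1]
      refine Real.log_le_log (Real.exp_pos 1) ?_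
      have := Real.exp_one_lt_d9
      linarith [abs_nonneg (n : ℝ)]
    -- `log q + log(|n|+4) ≤ (log q + 1) log(|n|+4) ≤ (log q + 1)(x + |y₀| + 4)`
    have hL : Real.log q + Real.log (|(n : ℝ)| + 4) ≤ (Real.log q + 1) * (x + |y₀| + 4) := by
      have h1 : Real.log q + Real.log (|(n : ℝ)| + 4) ≤ (Real.log q + 1) * Real.log (|(n : ℝ)| + 4) := by
        nlinarith
      exact h1.trans (mul_le_mul_of_nonneg_left hlog (by positivity))
    have h2 : Real.exp (-(2 * ν * x)) = Real.exp (-(ν * x)) * Real.exp (-(ν * x)) := by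
      rw [← Real.exp_add]; ring_nf
    have h3 : (x + |y₀| + 4) * Real.exp (-(ν * x)) ≤ 1 / ν + |y₀| + 4 := by
      have := mul_exp_neg_mul_le hν x
      have h4 : Real.exp (-(ν * x)) ≤ 1 := by
        rw [Real.exp_le_one_iff]; nlinarith
      nlinarith [abs_nonneg y₀, Real.exp_pos (-(ν * x))]
    have h5 : Real.exp (-(ν * x)) ≤ Real.exp (ν * |y₀|) * Real.exp (-(ν * |(n : ℝ)|)) := by
      rw [← Real.exp_add]
      refine Real.exp_le_exp.2 ?_
      have : |(n : ℝ)| ≤ x + |y₀| := by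
        have := abs_add_le ((n : ℝ) - y₀) y₀; rwa [sub_add_cancel] at this
      nlinarith
    calc 4 * Real.exp ν * Real.exp (-(2 * ν * x)) * (C * (Real.log q + Real.log (|(n : ℝ)| + 4)))
        ≤ 4 * Real.exp ν * Real.exp (-(2 * ν * x)) * (C * ((Real.log q + 1) * (x + |y₀| + 4))) := by gcongr
      _ = 4 * Real.exp ν * C * (Real.log q + 1) * ((x + |y₀| + 4) * Real.exp (-(ν * x))) *
            Real.exp (-(ν * x)) := by
          rw [h2]; ring
      _ ≤ 4 * Real.exp ν * C * (Real.log q + 1) * (1 / ν + |y₀| + 4) * Real.exp (-(ν * x)) := by gcongr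
      _ ≤ 4 * Real.exp ν * C * (Real.log q + 1) * (1 / ν + |y₀| + 4) *
            (Real.exp (ν * |y₀|) * Real.exp (-(ν * |(n : ℝ)|))) := by gcongr
      _ = K * Real.exp (-(ν * |(n : ℝ)|)) := by rw [hK]; ring
  have h := integrableOn_iUnion_of_summable_integral_norm (fun n ↦ (hwin n).1) hsum
  rwa [hs, iUnion_Icc_int_half, integrableOn_univ] at h

/-- **Khale's / Ford's parametrisation**: for `χ ≠ χ₀`, `1/2 ≤ σ ≤ 3`, `a > 0` and real `t`,
`u ↦ log|L(σ + i(t + au), χ)|/cosh²u` is integrable on `ℝ` (so the integrals of Lemmas 5.2, 6.2 of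
the source are genuine Lebesgue integrals). [cite: Khale2024, Lemma 5.2 (proof)] -/
theorem integrable_log_norm_LFunction_ford {q : ℕ} [NeZero q] {χ : DirichletCharacter ℂ q}
    (hχ : χ ≠ 1) {σ : ℝ} (hσ : σ ∈ Icc (1 / 2 : ℝ) 3) (t : ℝ) {a : ℝ} (ha : 0 < a) :
    Integrable fun u : ℝ ↦
      Real.log ‖χ.LFunction ((σ : ℂ) + ((t + u * a : ℝ) : ℂ) * I)‖ / Real.cosh u ^ 2 := by
  have G := integrable_log_norm_LFunction_div_cosh_sq hχ hσ (ν := 1 / a) (by positivity) t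
  have H := (G.comp_add_right t).comp_mul_right' ha.ne'
  refine H.congr (ae_of_all _ fun u ↦ ?_)
  have e1 : ((u * a + t : ℝ) : ℂ) = ((t + u * a : ℝ) : ℂ) := by push_cast; ring
  have e2 : 1 / a * (u * a + t - t) = u := by field_simp; ring
  show Real.log ‖χ.LFunction (σ + ((u * a + t : ℝ) : ℂ) * I)‖ / Real.cosh (1 / a * (u * a + t - t)) ^ 2 =
    Real.log ‖χ.LFunction (σ + ((t + u * a : ℝ) : ℂ) * I)‖ / Real.cosh u ^ 2
  rw [e1, e2]

end DirichletLogNormVertical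

end Literature.NumberTheory.LFunctions
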